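import Mathlib

/-!
# Fourier–Mukai ANCHOR RANK law — MINT block B4 «alphabet FM», kernel certificate of the whole-group rank law
# (hsemireg-alphabet-fm-1 g6, 2026-08-29)

Crux of record: `Summit.HodgeConjecture.HodgeConjecture.Theses.EightfoldBlochSeeds.BlochSeedDiscOne`
(`:= HasHyperbolicBlochSeed 4 1`; item stmt-HodgeConjecture-18881; skeleton `Cruxes/BlochSeedDiscOne/Lines/birth.lean`,
STUB R `stub_rung_pad4_seedAt` — UNTOUCHED here).  **Nothing in this file proves or approaches HC, HC_AV, HC_CM, H2,
№4/26512 or item 18881**: it is Mathlib-only integer/rational arithmetic (no `sorry`, no `instance`, no `notation`,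
no `axiom`), the ARITHMETIC CORE of the g5 memo `FM-ANCHOR-GROUP-LEDGER-fm1-g5.md` (cfa0b51d3f4cd598) THEOREM Q and
COROLLARY B∞ («rank-4 rigidity of the clean design class under every autoequivalence of `D^b(X₀)`»), which the critic
idea-crit-6 g13 passed by pen (bus l.8086) and the director booked in R19.347 (bus l.8058: «B4 CLOSED — NO DOOR; §2–§4
BANKED»).  The geometric inputs (Orlov: `Φ^H` is an isometry of `H*(X₀, ℤ)`; g5 THEOREM F: `Φ^H = n·s` with `n ∈ N(C)`
acting on the `h`-string through `GL₂` on binary octics and `s ∈ exp 𝔲_v` fixing `1, h, e⁴, ē⁴`) enter only through the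
shape of the hypotheses below; what the kernel checks is the bookkeeping that turns them into the rank law.  Seats
produce evidence and typed files, not rungs.  Companion files of this unit: `FourierMukaiLetterLaw.lean` (g1),
`FourierMukaiTransportLaw.lean` (g2), `FourierMukaiModularLaw.lean` (g4: the `PSL₂(ℤ)` = sideways sub-case).

## Dictionary (g5 §4; anchor `X₀ = E_i⁸`, principal product polarisation `h`, `h⁸ = 8!·pt`, clean ring
## `C = ℚ(i)[h] ⊕ ℚ(i)e⁴ ⊕ ℚ(i)ē⁴`, design class `v = 4 − κ·h + μe⁴ + μ̄ē⁴`, `κ = 1704` for ac808a66)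

* `Φ^H[𝒪_{X₀}] = n·1 ↔ (px + ry)⁸ = λ·(x + ρy)⁸ ↔ λ·e^{ρh}`, `ρ = R/Q` reduced.  Its coefficient on `h^k/k!` is
  `w k = λρ^k`, so **`w k · Q^k = w 0 · R^k`** (`hw` below); `Φ^H` integral (Orlov) and `h^k/k! = e_k(h₁,…,h₈)`
  integral PRIMITIVE for the principal product `h` ⇒ the vector `(w 0, …, w 8)` is integral and primitive (`hprim`).
  PART A (`headCoeff_eq_pow_eight_or_neg`): then `w 0 = ±Q⁸` («`p⁸ = ±Q⁸`», the sign slot = shift parity).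
* `Φ^H(h) = n·h ↔ e^{ρh}(α + βh)`; coefficient on `h^k/k!` is `c k = αρ^k + kβρ^{k−1}` (the `h·e^{ρh}` term
  contributes `kρ^{k−1}`); `k = 0, 1` give `α = c 0 ∈ ℤ`, `β = β'/Q`; then `c k = R^{k−1}(αR + kβ')/Q^k`
  (`hCoeff_closed_form`, over `ℚ`), i.e. **`c k · Q^k = R^{k−1}(αR + kβ')`** (`hc` below).
  PART B (`pow_seven_dvd`): integrality at `k = 7, 8` alone forces `Q⁷ ∣ β'` and **`Q⁷ ∣ α`**.
* `rank Φ^H(v)` = degree-0 component of `n·s·v = n·v'`, `v' = s·v = v` (`s` fixes `1, h, e⁴, ē⁴`), and `n ∈ N(C)` moves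
  `e⁴, ē⁴` inside degree 8 (critic's hardening (h2), g6 memo §2: `n ∈ N_G(L)`, `L = Z(C) = SL(W₊)`, normalises
  `C_G(L) = GL(M)` (`V ⊕ V* = W₊ ⊗ M ⊕ W₊* ⊗ M*`, Schur) and hence its central torus `τ_c = c·id_M`, which acts on `C`
  with weight `c⁰` on the `h`-string `⟨1, h, …, h⁸⟩ ∋ pt` and `c^{±8}` on `e⁴ ∈ ∧⁸W₊`, `ē⁴ ∈ ∧⁸W₋`; `n` permutes the
  `τ`-weight spaces fixing weight `0`, so `n·1, n·h ∈ h`-string and `n·e⁴, n·ē⁴ ∈ ℚ(i)e⁴ ∪ ℚ(i)ē⁴` carry no degree-0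
  component) ⇒ **`rank Φ^H(v) = 4·(w 0) − κ·(c 0)`**.  PART C (`rank_law_of_coefficients`): `= Q⁷(±4Q − κ·a)` =:
  `rankQ κ Q a s`.
* PART D (`rank_four_rigidity`, `rank_spectrum_1704`): `|rankQ κ Q a s| = 4` with `Q ≥ 1`, `|κ| > 8` forces `Q = 1`,
  `a = 0` — COROLLARY B∞: a rank-4 clean partner has integral frame slope and `α = 0`, hence (g5 THEOREM L, `t = 0`) is
  `± e^{mh}·A_*v`, a line-bundle twist of an automorphism image up to shift: **no non-trivial rank-4 clean FM partner of
  the design class under ANY autoequivalence**.  For `κ = 1704` the partner ranks lie in `{0, 4} ∪ [1024, ∞)`; `1024` is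
  attained at `(Q, a) = (2, 0)` (g5 §8: the curve-wise split modular pair `Φ₀`, digits re-checked in PART E), `0` at
  `Q = 426` (cusp-type), `1700, 1708, 3404, 3412, 13628, 13636` on the LINE frame `Q = 1` (g5 THEOREM L: `|4 + 1704t|`;
  `t = ∓8` are g4's unit columns `cleanOctic 4 1704 (±1) 1 = −13628, 13636`).
* SCOPE (bc5-plan g14 «POLARISATION TYPE OF THE ANCHOR», bus l.8089; director R19.350 (3): a census axis, OPEN-UNSTAFFED):
  the lattice step «`h^k/k!` primitive» is specific to the principal PRODUCT polarisation `h_std`; for a weighted product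
  polarisation `h = Σ w_c·p_c` the content of `h^k/k!` is `gcd_{|S|=k} w^S` and PART A's conclusion can fail (e.g.
  `λ = ±Q⁸/2` is arithmetically admissible for `w = (2,1,…,1)`, `Q = 2`, `R` odd) — the rank law, hence the arithmetic
  half of B∞, is NOT claimed off `h_std`.  What does transfer (by the graded scaling `σ` of that memo, an algebra
  automorphism over `ℝ` with `σ(h) = h_std`, `σ(W_±) = W_±`): the algebraic-group statements g5 THM Z/INV/N/S/F and
  verdict (i) «FM transports presentation types inside `Stab(v)`; it never converts a (B1♯)-failing class into a
  two-term one».  No seat needs more tonight (B4 CLOSED, R19.347).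
-/

namespace Summit.HodgeConjecture.HodgeConjecture.Cruxes.BlochSeedDiscOne.FourierMukaiAnchorRankLaw

/-! ## Part A — primitivity: the head coefficient of an integral primitive multiple of `e^{ρh}` is `±Q⁸` -/

/-- PART A (g5 THEOREM Q, step «`p⁸ = ±Q⁸`»).  `w k` = coefficient of `Φ^H[𝒪] = λ·e^{ρh}` on `h^k/k!`, `ρ = R/Q`
reduced (`IsCoprime R Q`), so `w k · Q^k = w 0 · R^k`; if the vector `(w 0, …, w 8)` is integral and primitive
(some `ℤ`-combination equals `1`), then `w 0 = ±Q⁸`. -/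
theorem headCoeff_eq_pow_eight_or_neg {Q R : ℤ} (w : ℕ → ℤ) (hQ : Q ≠ 0) (hcop : IsCoprime R Q)
    (hw : ∀ k, k ≤ 8 → w k * Q ^ k = w 0 * R ^ k)
    (hprim : ∃ d : ℕ → ℤ, ∑ k ∈ Finset.range 9, d k * w k = 1) :
    w 0 = Q ^ 8 ∨ w 0 = -(Q ^ 8) := by
  have h8 := hw 8 le_rfl
  have hdvd : Q ^ 8 ∣ w 0 * R ^ 8 := ⟨w 8, by rw [← h8]; ring⟩
  have hcop8 : IsCoprime (Q ^ 8) (R ^ 8) := hcop.symm.pow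
  obtain ⟨m, hm⟩ : Q ^ 8 ∣ w 0 := hcop8.dvd_of_dvd_mul_right hdvd
  have hwk : ∀ k, k ≤ 8 → w k = m * Q ^ (8 - k) * R ^ k := by
    intro k hk
    have e := hw k hk
    have hQk : Q ^ k ≠ 0 := pow_ne_zero _ hQ
    have hsplit : Q ^ 8 = Q ^ (8 - k) * Q ^ k := by
      rw [← pow_add, Nat.sub_add_cancel hk]
    have e' : w k * Q ^ k = (m * Q ^ (8 - k) * R ^ k) * Q ^ k := by
      rw [e, hm, hsplit]; ring
    exact mul_right_cancel₀ hQk e'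
  obtain ⟨d, hd⟩ := hprim
  have hm1 : m ∣ 1 := by
    rw [← hd]
    apply Finset.dvd_sum
    intro k hk
    have hk8 : k ≤ 8 := by
      have := Finset.mem_range.mp hk
      omega
    rw [hwk k hk8]
    exact ⟨d k * Q ^ (8 - k) * R ^ k, by ring⟩
  rcases Int.isUnit_iff.mp (isUnit_of_dvd_one hm1) with h1 | h1
  · left; rw [hm, h1, mul_one]
  · right; rw [hm, h1]; ring

/-! ## Part B — integrality of `Φ^H(h)` at `k = 7, 8` forces `Q⁷ ∣ α` -/

/-- The dictionary behind `hc`: the coefficient of `e^{ρh}(α + βh)` on `h^k/k!` is `αρ^k + kβρ^{k−1}`, and with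
`ρ = R/Q`, `β = β'/Q` it equals `R^{k−1}(αR + kβ')/Q^k` for `k ≥ 1` (pure field arithmetic over `ℚ`). -/
theorem hCoeff_closed_form (Q R α β' : ℚ) (hQ : Q ≠ 0) (k : ℕ) (hk : 1 ≤ k) :
    α * (R / Q) ^ k + k * (β' / Q) * (R / Q) ^ (k - 1)
      = R ^ (k - 1) * (α * R + k * β') / Q ^ k := by
  obtain ⟨j, rfl⟩ : ∃ j, k = j + 1 := ⟨k - 1, by omega⟩
  simp only [Nat.add_sub_cancel]
  rw [div_pow, div_pow, pow_succ R j, pow_succ Q j]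
  field_simp

/-- PART B (g5 THEOREM Q, step «`Q⁷ ∣ α`»; critic l.8086 ✓).  From the integrality of the `h⁷/7!` and `h⁸/8!`
coefficients of `Φ^H(h)` alone: `Q⁷ ∣ β'` and `Q⁷ ∣ α`. -/
theorem pow_seven_dvd {Q R α β' : ℤ} (hcop : IsCoprime R Q)
    (h7 : Q ^ 7 ∣ R ^ 6 * (α * R + 7 * β')) (h8 : Q ^ 8 ∣ R ^ 7 * (α * R + 8 * β')) :
    Q ^ 7 ∣ β' ∧ Q ^ 7 ∣ α := by
  have c7 : IsCoprime (Q ^ 7) (R ^ 6) := hcop.symm.pow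
  have c8 : IsCoprime (Q ^ 8) (R ^ 7) := hcop.symm.pow
  have d7 : Q ^ 7 ∣ α * R + 7 * β' := c7.dvd_of_dvd_mul_left h7
  have d8' : Q ^ 8 ∣ α * R + 8 * β' := c8.dvd_of_dvd_mul_left h8
  have d8 : Q ^ 7 ∣ α * R + 8 * β' := (pow_dvd_pow Q (by norm_num : 7 ≤ 8)).trans d8'
  have hb : Q ^ 7 ∣ β' := by
    have hsub := dvd_sub d8 d7
    have e : α * R + 8 * β' - (α * R + 7 * β') = β' := by ring
    rwa [e] at hsub
  refine ⟨hb, ?_⟩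
  have hαR : Q ^ 7 ∣ α * R := by
    have hsub := dvd_sub d7 (dvd_mul_of_dvd_right hb 7)
    have e : α * R + 7 * β' - 7 * β' = α * R := by ring
    rwa [e] at hsub
  have c1 : IsCoprime (Q ^ 7) R := hcop.symm.pow_left
  exact c1.dvd_of_dvd_mul_right hαR

/-- The full-range form actually stated by g5 / the critic («`Q^k ∣ αR + kβ'` for `k = 1..8`, differences give
`Q^k ∣ β'` for `k ≤ 7`, hence `Q⁷ ∣ α`») — it only needs the two top degrees. -/
theorem pow_seven_dvd_of_all {Q R α β' : ℤ} (hcop : IsCoprime R Q)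
    (h : ∀ k : ℕ, 1 ≤ k → k ≤ 8 → Q ^ k ∣ R ^ (k - 1) * (α * R + (k : ℤ) * β')) : Q ^ 7 ∣ α := by
  have h7 := h 7 (by norm_num) (by norm_num)
  have h8 := h 8 (by norm_num) (by norm_num)
  norm_num at h7 h8
  exact (pow_seven_dvd hcop h7 h8).2

/-! ## Part C — the rank law `rank Φ^H(v) = Q⁷(±4Q − κ·a)` -/

/-- The whole-group rank value: frame denominator `Q`, sign `s = ±1` (shift parity), `a ∈ ℤ` (`α = Q⁷a`). -/
def rankQ (κ Q a s : ℤ) : ℤ := Q ^ 7 * (s * 4 * Q - κ * a)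

theorem rankQ_def (κ Q a s : ℤ) : rankQ κ Q a s = Q ^ 7 * (s * 4 * Q - κ * a) := rfl

/-- PART C (g5 THEOREM Q assembled).  Hypotheses = the dictionary of the header: `w` = `h^k/k!`-coefficients of
`Φ^H[𝒪]` (geometric progression `λρ^k`, integral, primitive), `c` = those of `Φ^H(h)` (`c 0 = α`,
`c k·Q^k = R^{k−1}(αR + kβ')`, integral because `c k ∈ ℤ`).  Conclusion: the degree-0 component `4·w 0 − κ·c 0` of
`Φ^H(v)`, `v = 4 − κh + μe⁴ + μ̄ē⁴`, is `Q⁷(±4Q − κa)` for some `a ∈ ℤ`. -/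
theorem rank_law_of_coefficients {Q R α β' : ℤ} (κ : ℤ) (w c : ℕ → ℤ) (hQ : Q ≠ 0) (hcop : IsCoprime R Q)
    (hw : ∀ k, k ≤ 8 → w k * Q ^ k = w 0 * R ^ k)
    (hprim : ∃ d : ℕ → ℤ, ∑ k ∈ Finset.range 9, d k * w k = 1)
    (hc0 : c 0 = α)
    (hc : ∀ k : ℕ, 1 ≤ k → k ≤ 8 → c k * Q ^ k = R ^ (k - 1) * (α * R + (k : ℤ) * β')) :
    ∃ a s : ℤ, (s = 1 ∨ s = -1) ∧ 4 * w 0 - κ * c 0 = rankQ κ Q a s := by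
  have e7 := hc 7 (by norm_num) (by norm_num)
  have e8 := hc 8 (by norm_num) (by norm_num)
  norm_num at e7 e8
  have h7 : Q ^ 7 ∣ R ^ 6 * (α * R + 7 * β') := ⟨c 7, by linarith⟩
  have h8 : Q ^ 8 ∣ R ^ 7 * (α * R + 8 * β') := ⟨c 8, by linarith⟩
  obtain ⟨-, ⟨a, ha⟩⟩ := pow_seven_dvd hcop h7 h8
  rcases headCoeff_eq_pow_eight_or_neg w hQ hcop hw hprim with h0 | h0
  · exact ⟨a, 1, Or.inl rfl, by rw [h0, hc0, ha, rankQ]; ring⟩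
  · exact ⟨a, -1, Or.inr rfl, by rw [h0, hc0, ha, rankQ]; ring⟩

/-! ## Part D — COROLLARY B∞ (rank-4 rigidity) and the partner-rank spectrum for `κ = 1704` -/

/-- `κ·a` cannot hit a non-zero target of absolute value `< |κ|`. -/
theorem mul_ne_of_abs_lt {κ a t : ℤ} (hκ : |t| < |κ|) (ht : t ≠ 0) : κ * a ≠ t := by
  rintro rfl
  have ha : a ≠ 0 := by
    rintro rfl; simp at ht
  have h1 : 1 ≤ |a| := Int.one_le_abs ha
  have h2 : |κ| * 1 ≤ |κ| * |a| := mul_le_mul_of_nonneg_left h1 (abs_nonneg κ)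
  rw [abs_mul] at hκ
  linarith

/-- COROLLARY B∞ (arithmetic half; critic l.8086 ✓).  If `|κ| > 8` (ac808a66: `κ = 1704`; S131: `410016`), a
whole-group clean partner of rank `4` has `Q = 1` (integral frame slope) and `a = 0` (`α = 0`). -/
theorem rank_four_rigidity {κ Q a s : ℤ} (hQ : 1 ≤ Q) (hs : s = 1 ∨ s = -1) (hκ : 8 < |κ|)
    (h : |rankQ κ Q a s| = 4) : Q = 1 ∧ a = 0 := by
  unfold rankQ at h
  rcases lt_or_eq_of_le hQ with hQ2 | hQ1
  · -- `Q ≥ 2`: `|Q⁷·t| ∈ {0} ∪ [128, ∞)`, never `4`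
    exfalso
    have hQ2' : (2 : ℤ) ≤ Q := by omega
    have hQ7 : (2 : ℤ) ^ 7 ≤ Q ^ 7 := pow_le_pow_left₀ (by norm_num) hQ2' 7
    norm_num at hQ7
    have hpos : 0 < Q ^ 7 := pow_pos (by omega) 7
    rw [abs_mul, abs_of_pos hpos] at h
    by_cases ht : s * 4 * Q - κ * a = 0
    · rw [ht, abs_zero, mul_zero] at h; norm_num at h
    · have h1 : 1 ≤ |s * 4 * Q - κ * a| := Int.one_le_abs ht
      nlinarith
  · -- `Q = 1`: `|4s − κa| = 4` with `|κ| > 8` forces `κa = 0`, hence `a = 0`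
    subst hQ1
    refine ⟨rfl, ?_⟩
    have h' : |s * 4 - κ * a| = 4 := by simpa using h
    have hκ0 : κ ≠ 0 := by
      rintro rfl; simp at hκ
    have h8 : κ * a ≠ 8 := mul_ne_of_abs_lt (by simpa using hκ) (by norm_num)
    have h8' : κ * a ≠ -8 := mul_ne_of_abs_lt (by simpa using hκ) (by norm_num)
    have key : κ * a = 0 := by
      rcases (abs_eq (by norm_num : (0:ℤ) ≤ 4)).mp h' with e | e <;> rcases hs with hs1 | hs1 <;> omega
    exact (mul_eq_zero.mp key).resolve_left hκ0

/-- ac808a66 (`κ = 1704`) and S131 (`κ̄ = 410016`) satisfy the hypothesis of `rank_four_rigidity`. -/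
theorem kappa_hyp_ac808a66 : 8 < |(1704 : ℤ)| ∧ 8 < |(410016 : ℤ)| := by norm_num

private theorem big_of_le {x : ℤ} (h : 1024 ≤ x ∨ x ≤ -1024) : 1024 ≤ |x| := by
  rcases h with h | h
  · exact le_abs.mpr (Or.inl h)
  · exact le_abs.mpr (Or.inr (by linarith))

/-- PARTNER-RANK SPECTRUM for ac808a66 (`κ = 1704`; g5 COROLLARY «spectrum», critic ✓): every whole-group value
`Q⁷(±4Q − 1704a)`, `Q ≥ 1`, is `0` (cusp-type: `Q = 426·|a|`), has absolute value `4` (the trivial partners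
`Q = 1, a = 0`), or has absolute value `≥ 1024`. -/
theorem rank_spectrum_1704 {Q a s : ℤ} (hQ : 1 ≤ Q) (hs : s = 1 ∨ s = -1) :
    rankQ 1704 Q a s = 0 ∨ |rankQ 1704 Q a s| = 4 ∨ 1024 ≤ |rankQ 1704 Q a s| := by
  unfold rankQ
  rcases lt_trichotomy Q 2 with hlt | rfl | hgt
  · obtain rfl : Q = 1 := by omega
    simp only [one_pow, one_mul, mul_one]
    by_cases ha : a = 0
    · subst ha; right; left
      rcases hs with rfl | rfl <;> norm_num
    · right; right
      exact big_of_le (by rcases hs with rfl | rfl <;> omega)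
  · right; right
    rw [show (2:ℤ) ^ 7 * (s * 4 * 2 - 1704 * a) = 1024 * s - 218112 * a by ring]
    exact big_of_le (by rcases hs with rfl | rfl <;> omega)
  · by_cases ht : s * 4 * Q - 1704 * a = 0
    · left; rw [ht, mul_zero]
    · right; right
      have hQ7 : (3 : ℤ) ^ 7 ≤ Q ^ 7 := pow_le_pow_left₀ (by norm_num) (by omega) 7
      norm_num at hQ7
      have hpos : 0 < Q ^ 7 := pow_pos (by omega) 7
      rw [abs_mul, abs_of_pos hpos]
      have h1 : 1 ≤ |s * 4 * Q - 1704 * a| := Int.one_le_abs ht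
      nlinarith

/-- The trivial partners (`Q = 1`, `a = 0`: twists ∘ automorphisms ∘ shifts) have rank `4`. -/
theorem rankQ_1704_trivial {s : ℤ} (hs : s = 1 ∨ s = -1) : |rankQ 1704 1 0 s| = 4 := by
  rcases hs with rfl | rfl <;> norm_num [rankQ]

/-- The bound `1024` is attained: `Q = 2`, `a = 0` (g5 §8, the curve-wise split modular pair `Φ₀`). -/
theorem rankQ_1704_min_witness : rankQ 1704 2 0 1 = 1024 := by norm_num [rankQ]

/-- Rank `0` off the `Φ_𝒫` cusp: `Q = 426` (`4·426 = 1704`). -/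
theorem rankQ_1704_zero_witness : rankQ 1704 426 1 1 = 0 := by norm_num [rankQ]

/-- `Q ≥ 3` never gives a small non-zero rank: the first value there is `3⁷·|12 − 1704a| ≥ 26244`. -/
theorem rankQ_1704_Q3 : rankQ 1704 3 0 1 = 26244 := by norm_num [rankQ]

/-- The LINE frame `Q = 1` (g5 THEOREM L): `rankQ 1704 1 a 1 = 4 − 1704a = 4 + 1704·t` with `t = −a = tr_h y`. -/
theorem rankQ_1704_lineFrame (a : ℤ) : rankQ 1704 1 a 1 = 4 + 1704 * (-a) := by
  simp [rankQ]; ring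

/-- THEOREM L numerics (g5 §5 table): `t = 1, 2, −1, 8, −8 ↦ 1708, 3412, 1700, 13636, 13628`. -/
theorem lineFrame_values :
    (|4 + 1704 * (1:ℤ)|, |4 + 1704 * (2:ℤ)|, |4 + 1704 * (-1:ℤ)|, |4 + 1704 * (8:ℤ)|, |4 + 1704 * (-8:ℤ)|)
      = (1708, 3412, 1700, 13636, 13628) := by norm_num

/-- In the LINE frame rank `4` occurs only at `t = 0` (`1704 ∤ 8`). -/
theorem lineFrame_rank_four_iff (t : ℤ) : |4 + 1704 * t| = 4 ↔ t = 0 := by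
  constructor
  · intro h
    rcases (abs_eq (by norm_num : (0:ℤ) ≤ 4)).mp h with e | e <;> omega
  · rintro rfl; norm_num

/-- g4's unit columns of the clean octic `F(x,y) = x⁷(4x − 8·1704·y)` are THEOREM L at `t = ∓8`
(`exp(±Λ_h)`, `tr_h h = 8`): `F(1,1) = −13628 = 4 + 1704·(−8)`, `F(−1,1) = 13636 = 4 + 1704·8`. -/
theorem g4_unit_columns_are_lineFrame :
    (1:ℤ) ^ 7 * (4 * 1 - 8 * 1704 * 1) = 4 + 1704 * (-8) ∧
    (-1:ℤ) ^ 7 * (4 * (-1) - 8 * 1704 * 1) = 4 + 1704 * 8 := by norm_num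

/-! ## Part E — the realised rank-1024 partner `Φ₀` (g5 §8): digits, and PART C's hypotheses instantiated -/

/-- `Φ₀^H[𝒪] = 256·e^{h/2}`: coefficients `256·(1/2)^k` on `h^k/k!`, `k = 0..8` — integral, last one `1` (primitive),
head `256 = 2⁸` (`Q = 2`, `λ = +Q⁸`). -/
theorem phi0_O_coeffs :
    ((256:ℚ) * (1/2) ^ 0, (256:ℚ) * (1/2) ^ 1, (256:ℚ) * (1/2) ^ 2, (256:ℚ) * (1/2) ^ 3, (256:ℚ) * (1/2) ^ 4,
      (256:ℚ) * (1/2) ^ 5, (256:ℚ) * (1/2) ^ 6, (256:ℚ) * (1/2) ^ 7, (256:ℚ) * (1/2) ^ 8)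
      = (256, 128, 64, 32, 16, 8, 4, 2, 1) := by norm_num

/-- `Φ₀^H(h) = 64·h·e^{h/2}`: coefficients `k·64·(1/2)^{k−1}` on `h^k/k!`, `k = 1..8` (the `k = 0` coefficient is
`α = 0`): `64, 64, 48, 32, 20, 12, 7, 4` (g5 §8 / critic ✓). -/
theorem phi0_h_coeffs :
    ((1:ℚ) * 64 * (1/2) ^ 0, (2:ℚ) * 64 * (1/2) ^ 1, (3:ℚ) * 64 * (1/2) ^ 2, (4:ℚ) * 64 * (1/2) ^ 3,
      (5:ℚ) * 64 * (1/2) ^ 4, (6:ℚ) * 64 * (1/2) ^ 5, (7:ℚ) * 64 * (1/2) ^ 6, (8:ℚ) * 64 * (1/2) ^ 7)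
      = (64, 64, 48, 32, 20, 12, 7, 4) := by norm_num

/-- `Φ₀` bookkeeping: `λ = 256 = 2⁸` (`Q = 2`), `β = 64 = β'/Q` with `β' = 128 = 2⁷` (PART B is SHARP: `2⁸ ∤ 128`),
rank `4·256 − 1704·0 = 1024`, degree-1 coefficient `4·128 − 1704·64 = −108544 = [h¹](e^{h/2}(1024 − 109056h))`. -/
theorem phi0_data :
    (256:ℤ) = 2 ^ 8 ∧ (64:ℚ) = 128 / 2 ∧ (2:ℤ) ^ 7 ∣ 128 ∧ ¬ ((2:ℤ) ^ 8 ∣ 128) ∧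
    (4:ℤ) * 256 - 1704 * 0 = rankQ 1704 2 0 1 ∧ (4:ℤ) * 128 - 1704 * 64 = -108544 ∧
    (1024:ℚ) * (1/2) - 109056 = -108544 ∧ (1704:ℤ) * 64 = 109056 := by
  refine ⟨by norm_num, by norm_num, by norm_num, by norm_num, by norm_num [rankQ], by norm_num, by norm_num, by norm_num⟩

/-- `Φ₀`'s `h^k/k!`-coefficients of `Φ₀^H[𝒪]` as an integer sequence: `2^{8−k}`. -/
def phi0w (k : ℕ) : ℤ := 2 ^ (8 - k)

/-- `Φ₀`'s `h^k/k!`-coefficients of `Φ₀^H(h)`: `k·2^{7−k}` (`k ≤ 7`), `4` (`k = 8`). -/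
def phi0c (k : ℕ) : ℤ := if k ≤ 7 then (k : ℤ) * 2 ^ (7 - k) else if k = 8 then 4 else 0

theorem phi0c_values :
    (phi0c 0, phi0c 1, phi0c 2, phi0c 3, phi0c 4, phi0c 5, phi0c 6, phi0c 7, phi0c 8)
      = (0, 64, 64, 48, 32, 20, 12, 7, 4) := by
  simp [phi0c]

/-- PART C's hypotheses hold for `Φ₀` with `Q = 2`, `R = 1`, `α = 0`, `β' = 128`, and the law returns
`4·256 − 0 = rankQ 1704 2 a s` (necessarily `a = 0`, `s = 1`: value `1024`). -/
theorem phi0_rank_law :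
    ∃ a s : ℤ, (s = 1 ∨ s = -1) ∧ 4 * phi0w 0 - 1704 * phi0c 0 = rankQ 1704 2 a s :=
  rank_law_of_coefficients (Q := 2) (R := 1) (α := 0) (β' := 128) 1704 phi0w phi0c (by norm_num)
    isCoprime_one_left
    (by intro k hk; interval_cases k <;> simp [phi0w])
    ⟨fun k => if k = 8 then 1 else 0, by simp [phi0w]⟩
    (by simp [phi0c])
    (by intro k hk1 hk8; interval_cases k <;> simp [phi0c])

theorem phi0_rank : 4 * phi0w 0 - 1704 * phi0c 0 = 1024 := by norm_num [phi0w, phi0c]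

end Summit.HodgeConjecture.HodgeConjecture.Cruxes.BlochSeedDiscOne.FourierMukaiAnchorRankLaw
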